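import Literature.InformationTheory.QuantumCodes.MatchingDecodersBoundary
import Literature.InformationTheory.QuantumCodes.HypergraphProductThresholds
import HarnessLib

/-!
# The planar surface codes are graphlike with boundary: every qubit meets at most two checks of each type

Topic `Literature/InformationTheory/QuantumCodes` (venture QEC, LADDER-QEC Q5 «toric/SURFACE + MWPM»; qec-type-09 gen 4).
Companion of `MatchingDecodersBoundary.lean` (MWPM with one virtual boundary check is minimum-weight decoding for
every check matrix whose columns have weight `≤ 2`, `exists_isGraphlikeVia_of_card_colSupp_le_two` +
`isMinWeight_boundaryDecoder`). Here the hypothesis is discharged for the tree's PLANAR SURFACE CODES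
(`HypergraphProductThresholds.lean`: `planarHX k = H_X(HGP(H, Hᵀ))`, `planarHZ k = H_Z(HGP(H, Hᵀ))`, `H` the
`(k+1) × (k+2)` repetition parity-check matrix `repMatrix`), i.e. Dennis–Kitaev–Landahl–Preskill's planar codes
with a rough and a smooth edge ("at the edge of the lattice … each `Z_P` or `X_s` … acts on only three qubits … a
chain can end on the boundary", §3.2): column weights of hypergraph-product matrices are bounded by the column /
row weights of the two classical seeds (`card_colSupp_xMatrix_inl_le`, `_inr_le`, `card_colSupp_zMatrix_inl_le`,
`_inr_le`), the repetition matrix has column and row weights `≤ 2`, hence **`card_colSupp_planarHX_le_two`**,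
**`card_colSupp_planarHZ_le_two`** and `exists_isGraphlikeVia_planarHX / _planarHZ`: both sectors of every planar
surface code are graphlike with boundary, so boundary-MWPM decoders are minimum-weight decoders for them
(`isMinWeight_boundaryDecoder`, and `isMinWeight_boundaryDecoder_st` for `T` noisy rounds). All PROVED, 0 facts.

## References
* [DennisEtAl2002] E. Dennis, A. Kitaev, A. Landahl, J. Preskill, *Topological quantum memory*, J. Math. Phys. 43
  (2002) 4452–4505, arXiv:quant-ph/0110143, §3.2 (planar codes) and §4.4 p. 18.
* [TillichZemor2014] J.-P. Tillich, G. Zémor, *Quantum LDPC codes with positive rate and minimum distance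
  proportional to n^{1/2}*, IEEE Trans. Inform. Theory 60 (2014) 1193–1202, §3 (product with the transpose of a
  repetition code = planar code).
-/

namespace Literature.InformationTheory.QuantumCodes

open Finset Matrix HypergraphProduct

/-! ### Column weights of hypergraph-product matrices -/

section HGP

variable {V₁ E₁ V₂ E₂ : Type*} [Fintype V₁] [DecidableEq V₁] [Fintype E₁] [DecidableEq E₁]
  [Fintype V₂] [DecidableEq V₂] [Fintype E₂] [DecidableEq E₂]
  (H₁ : Matrix V₁ E₁ (ZMod 2)) (H₂ : Matrix V₂ E₂ (ZMod 2))

omit [Fintype E₁] [DecidableEq E₁] [Fintype E₂] [DecidableEq E₂] in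
/-- A column of `H_X` of a hypergraph product over an edge `αb'` of type `E_R` has at most as many checks as the
column `α` of `H₁`. [cite: TillichZemor2014, §3 (vertex (a,b) incident to αb' iff a ∈ α and b = b')] -/
theorem card_colSupp_xMatrix_inl_le (α : E₁) (b' : V₂) :
    (colSupp (xMatrix H₁ H₂) (Sum.inl (α, b'))).card ≤ (colSupp H₁ α).card := by
  refine le_trans (card_le_card (t := (colSupp H₁ α).image fun a : V₁ => (a, b')) ?_) card_image_le
  rintro ⟨a, b⟩ h
  simp only [colSupp, mem_filter, mem_univ, true_and, xMatrix_apply_inl] at h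
  rw [mem_image]
  by_cases hb : b = b'
  · subst hb
    refine ⟨a, ?_, rfl⟩
    simp only [colSupp, mem_filter, mem_univ, true_and]
    intro h0; exact h (by rw [h0, zero_mul])
  · exact absurd (by rw [if_neg hb, mul_zero]) h

omit [Fintype E₁] [DecidableEq E₁] [Fintype E₂] [DecidableEq E₂] in
/-- A column of `H_X` over an edge `a'β` of type `E_L` has at most as many checks as the column `β` of `H₂`.
[cite: TillichZemor2014, §3 (vertex (a,b) incident to a'β iff a = a' and b ∈ β)] -/
theorem card_colSupp_xMatrix_inr_le (a' : V₁) (β : E₂) :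
    (colSupp (xMatrix H₁ H₂) (Sum.inr (a', β))).card ≤ (colSupp H₂ β).card := by
  refine le_trans (card_le_card (t := (colSupp H₂ β).image fun b : V₂ => (a', b)) ?_) card_image_le
  rintro ⟨a, b⟩ h
  simp only [colSupp, mem_filter, mem_univ, true_and, xMatrix_apply_inr] at h
  rw [mem_image]
  by_cases ha : a = a'
  · subst ha
    refine ⟨b, ?_, rfl⟩
    simp only [colSupp, mem_filter, mem_univ, true_and]
    intro h0; exact h (by rw [h0, mul_zero])
  · exact absurd (by rw [if_neg ha, zero_mul]) h

omit [Fintype V₁] [DecidableEq V₁] [Fintype V₂] [DecidableEq V₂] in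
/-- A column of `H_Z` over an edge `α'b` of type `E_R` has at most as many chambers as the row `b` of `H₂` has
edges. [cite: TillichZemor2014, §3 (chamber (α,β) ∋ α'b iff α' = α and b ∈ β)] -/
theorem card_colSupp_zMatrix_inl_le (α' : E₁) (b : V₂) :
    (colSupp (zMatrix H₁ H₂) (Sum.inl (α', b))).card ≤ (univ.filter fun β : E₂ => H₂ b β ≠ 0).card := by
  refine le_trans (card_le_card (t := (univ.filter fun β : E₂ => H₂ b β ≠ 0).image fun β : E₂ => (α', β)) ?_) card_image_le
  rintro ⟨α, β⟩ h
  simp only [colSupp, mem_filter, mem_univ, true_and, zMatrix_apply_inl] at h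
  rw [mem_image]
  by_cases hα : α = α'
  · subst hα
    refine ⟨β, ?_, rfl⟩
    simp only [mem_filter, mem_univ, true_and]
    intro h0; exact h (by rw [h0, mul_zero])
  · exact absurd (by rw [if_neg hα, zero_mul]) h

omit [Fintype V₁] [DecidableEq V₁] [Fintype V₂] [DecidableEq V₂] in
/-- A column of `H_Z` over an edge `aβ'` of type `E_L` has at most as many chambers as the row `a` of `H₁` has
edges. [cite: TillichZemor2014, §3 (chamber (α,β) ∋ aβ' iff a ∈ α and β' = β)] -/
theorem card_colSupp_zMatrix_inr_le (a : V₁) (β' : E₂) :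
    (colSupp (zMatrix H₁ H₂) (Sum.inr (a, β'))).card ≤ (univ.filter fun α : E₁ => H₁ a α ≠ 0).card := by
  refine le_trans (card_le_card (t := (univ.filter fun α : E₁ => H₁ a α ≠ 0).image fun α : E₁ => (α, β')) ?_) card_image_le
  rintro ⟨α, β⟩ h
  simp only [colSupp, mem_filter, mem_univ, true_and, zMatrix_apply_inr] at h
  rw [mem_image]
  by_cases hβ : β = β'
  · subst hβ
    refine ⟨α, ?_, rfl⟩
    simp only [mem_filter, mem_univ, true_and]
    intro h0; exact h (by rw [h0, zero_mul])
  · exact absurd (by rw [if_neg hβ, mul_zero]) h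

end HGP

/-! ### The repetition matrix has column and row weights `≤ 2` -/

/-- Every bit of the repetition code is checked by at most two checks (`x_j` enters `x_{j-1}+x_j` and
`x_j+x_{j+1}`). [cite: TillichZemor2014, §3 (repetition code)] -/
theorem card_colSupp_repMatrix_le_two (n : ℕ) (j : Fin (n + 1)) : (colSupp (repMatrix n) j).card ≤ 2 := by
  have hsub : colSupp (repMatrix n) j ⊆
      (univ.filter fun i : Fin n => i.castSucc = j) ∪ (univ.filter fun i : Fin n => i.succ = j) := by
    intro i hi
    simp only [colSupp, mem_filter, mem_univ, true_and, repMatrix, of_apply] at hi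
    rw [mem_union, mem_filter, mem_filter]
    by_cases h : j = i.castSucc ∨ j = i.succ
    · rcases h with h | h
      · exact Or.inl ⟨mem_univ _, h.symm⟩
      · exact Or.inr ⟨mem_univ _, h.symm⟩
    · exact absurd (if_neg h) hi
  have h1 : (univ.filter fun i : Fin n => i.castSucc = j).card ≤ 1 :=
    card_le_one.2 fun a ha b hb => Fin.castSucc_injective n
      ((mem_filter.1 ha).2.trans (mem_filter.1 hb).2.symm)
  have h2 : (univ.filter fun i : Fin n => i.succ = j).card ≤ 1 :=
    card_le_one.2 fun a ha b hb => Fin.succ_injective n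
      ((mem_filter.1 ha).2.trans (mem_filter.1 hb).2.symm)
  exact (card_le_card hsub).trans ((card_union_le _ _).trans (by omega))

/-- Every repetition check involves exactly the two bits `x_i`, `x_{i+1}`: row weight `≤ 2`.
[cite: TillichZemor2014, §3 (repetition code)] -/
theorem card_rowFilter_repMatrix_le_two (n : ℕ) (i : Fin n) :
    (univ.filter fun j : Fin (n + 1) => repMatrix n i j ≠ 0).card ≤ 2 := by
  have hsub : (univ.filter fun j : Fin (n + 1) => repMatrix n i j ≠ 0) ⊆ {i.castSucc, i.succ} := by
    intro j hj
    simp only [mem_filter, mem_univ, true_and, repMatrix, of_apply] at hj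
    rw [mem_insert, mem_singleton]
    by_contra h
    exact hj (if_neg h)
  exact (card_le_card hsub).trans (card_insert_le _ _)

/-! ### Planar surface codes: both check matrices have column weight `≤ 2` -/

/-- **Every qubit of the planar surface code meets at most two `X`-checks** (two in the bulk, one at the rough
edge). [cite: DennisEtAl2002, §3.2 (planar code: three-qubit operators at the edge)] -/
theorem card_colSupp_planarHX_le_two (k : ℕ) (q : PlanarQubit k) : (colSupp (planarHX k) q).card ≤ 2 := by
  rcases q with ⟨α, b'⟩ | ⟨a', β⟩
  · exact (card_colSupp_xMatrix_inl_le _ _ α b').trans (card_colSupp_repMatrix_le_two _ α)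
  · refine (card_colSupp_xMatrix_inr_le _ _ a' β).trans ?_
    -- column `β` of `Hᵀ` = row `β` of `H`
    have : colSupp (repMatrix (k + 1))ᵀ β = univ.filter fun j : Fin (k + 2) => repMatrix (k + 1) β j ≠ 0 := by
      simp only [colSupp, transpose_apply]
    rw [this]
    exact card_rowFilter_repMatrix_le_two _ β

/-- **Every qubit of the planar surface code meets at most two `Z`-checks** (two in the bulk, one at the smooth
edge). [cite: DennisEtAl2002, §3.2 (planar code: three-qubit operators at the edge)] -/
theorem card_colSupp_planarHZ_le_two (k : ℕ) (q : PlanarQubit k) : (colSupp (planarHZ k) q).card ≤ 2 := by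
  rcases q with ⟨α', b⟩ | ⟨a, β'⟩
  · refine (card_colSupp_zMatrix_inl_le _ _ α' b).trans ?_
    have : (univ.filter fun β : Fin (k + 1) => (repMatrix (k + 1))ᵀ b β ≠ 0) = colSupp (repMatrix (k + 1)) b := by
      simp only [colSupp, transpose_apply]
    rw [this]
    exact card_colSupp_repMatrix_le_two _ b
  · exact (card_colSupp_zMatrix_inr_le _ _ a β').trans (card_rowFilter_repMatrix_le_two _ a)

/-- Hence **the `X`-check matrix of every planar surface code is graphlike with boundary** (some link-end map
`ι : PlanarQubit k → Sym2 (Option (PlanarCheck k))` presents it). [cite: DennisEtAl2002, §3.2 and §4.4 p. 18] -/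
theorem exists_isGraphlikeVia_planarHX (k : ℕ) :
    ∃ ι : PlanarQubit k → Sym2 (Option (PlanarCheck k)), IsGraphlikeVia (planarHX k) ι :=
  exists_isGraphlikeVia_of_card_colSupp_le_two _ (card_colSupp_planarHX_le_two k)

/-- … and so is the `Z`-check matrix. [cite: DennisEtAl2002, §3.2 and §4.4 p. 18] -/
theorem exists_isGraphlikeVia_planarHZ (k : ℕ) :
    ∃ ι : PlanarQubit k → Sym2 (Option (PlanarZCheck k)), IsGraphlikeVia (planarHZ k) ι :=
  exists_isGraphlikeVia_of_card_colSupp_le_two _ (card_colSupp_planarHZ_le_two k)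

end Literature.InformationTheory.QuantumCodes
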